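import Literature.Analysis.FluidPDE.JetStepArithmetic
import HarnessLib

/-!
# The time-weighted jet step: power counting in the relaxed regime (BV 2019, §2.1–2.3; BV §7.7)

Analysis/FluidPDE support file (everything proved): the uniform power-counting calculus of
`JetStepArithmetic` (`UBnd`) re-run for the RELAXED parameter regime `StepPars.RegimeW` of the energy
iteration of Buckmaster–Vicol (Ann. of Math. 189 (2019)), in which the amplitude floor `γ₀ ≍ δ_{q+1}` may
exceed `1` by a tiny power of the frequency (`γ₀ ≤ L^{1/(20 b₀)}` instead of `γ₀ ≤ 1`; at `q = 0`,
`δ₁ = λ₁^β > 1`), together with the power counting of the additional size functions of the weighted step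
`JetStep.jet_step_weighted` (cut-off terms of the `L¹` and sup stress, `C⁰` size, the three energy errors):
`JetStep.StepPars.step_arith_weighted`. The proofs are those of `JetStepArithmetic` verbatim (structural
power counting by `repeat' (first | leaf | rule)`), with the two leaves `γ₀, δ` of exponent `1/(20 b₀)`.

## References

* T. Buckmaster, V. Vicol, Ann. of Math. 189 (2019) = arXiv:1709.10033, §2.1–2.3, §7. [`BuckmasterVicol2019Annals`]
* T. Buckmaster, V. Vicol, EMS Surv. Math. Sci. 6 (2019) = arXiv:1901.09023, §7.7. [`BuckmasterVicol2020`]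
-/

noncomputable section

open MeasureTheory Set Filter Topology Function
open scoped InnerProductSpace ContDiff ENNReal NNReal

namespace Literature.Analysis.FluidPDE

namespace JetStep

open Literature.Analysis.FunctionSpaces FunctionSpaces.Torus Mikado NashGeometric Jet

/-! ## The parameter regime -/

/-- **The parameter regime of the weighted step at frequency `L`** (`lam ≤ L^{1/b₀}`): as
`StepPars.Regime` (`σ = L^{3/16}`, `κ = L^{1/2}`, `μ = L^{13/16}`, `μ′ = L^{5/4}`, `ℓ = L^{-1/16}`, `V = lam⁴`,
`A = lam^{10}`, `δ ≤ γ₀`, `γ₀ ≥ L^{-1/(20b₀)}`) but with the upper bound `γ₀ ≤ 1` relaxed to `γ₀ ≤ L^{1/(20b₀)}`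
(the energy iteration of BV 2019 has `γ₀ ≍ δ_{q+1}`, and `δ₁ = λ₁^β > 1`). [cite: BuckmasterVicol2020, §7.7; BuckmasterVicol2019Annals, §2.1] -/
structure StepPars.RegimeW (P : StepPars) (L lam : ℝ) : Prop where
  hL : 1 ≤ L
  hlam : 1 ≤ lam
  hlamL : lam ≤ L ^ (1 / B0)
  hσ : (P.σ : ℝ) = L ^ (3 / 16 : ℝ)
  hκ : P.κ = L ^ (1 / 2 : ℝ)
  hμ : P.μ = L ^ (13 / 16 : ℝ)
  hmup : P.mup = L ^ (5 / 4 : ℝ)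
  hℓ : P.ℓ = L ^ (-(1 / 16 : ℝ))
  hV : P.V = lam ^ 4
  hA : P.A = lam ^ 10
  hδγ : P.δ ≤ P.γ₀
  hγ1 : P.γ₀ ≤ L ^ (1 / (20 * B0))
  hγlow : L ^ (-(1 / (20 * B0))) ≤ P.γ₀

namespace StepPars

variable {P : StepPars} {L lam : ℝ}

/-- `Θ = L^{1/16}`. [folklore] -/
theorem RegimeW.hΘ (hR : P.RegimeW L lam) : P.Θ = L ^ (1 / 16 : ℝ) := by
  have hL0 : 0 < L := by linarith [hR.hL]
  show P.ℓ⁻¹ = _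
  rw [hR.hℓ, Real.rpow_neg hL0.le, inv_inv]

/-- `λ_q^n ≤ L^{n/b₀}`. [folklore] -/
theorem RegimeW.lam_pow_le (hR : P.RegimeW L lam) (n : ℕ) : lam ^ n ≤ L ^ ((n : ℝ) / B0) := by
  have hL0 : 0 < L := by linarith [hR.hL]
  rw [show (n : ℝ) / B0 = (1 / B0) * n by ring, Real.rpow_mul_natCast hL0.le]
  exact pow_le_pow_left₀ (by linarith [hR.hlam]) hR.hlamL n

/-- `γ₀⁻¹ ≤ L^{1/(20 b₀)}`. [folklore] -/
theorem RegimeW.inv_γ_le (hP : P.Valid) (hR : P.RegimeW L lam) : P.γ₀⁻¹ ≤ L ^ (1 / (20 * B0)) := by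
  have hL0 : 0 < L := by linarith [hR.hL]
  have h1 : P.γ₀⁻¹ ≤ (L ^ (-(1 / (20 * B0))))⁻¹ := (inv_le_inv₀ hP.hγ (Real.rpow_pos_of_pos hL0 _)).2 hR.hγlow
  rwa [← Real.rpow_neg hL0.le, neg_neg] at h1

/-- `√γ₀ ≥ L^{-1/(40 b₀)}`. [folklore] -/
theorem RegimeW.rpow_le_sqrt_γ (hR : P.RegimeW L lam) : L ^ (-(1 / (40 * B0))) ≤ Real.sqrt P.γ₀ := by
  have hL0 : 0 < L := by linarith [hR.hL]
  have h := Real.sqrt_le_sqrt hR.hγlow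
  rwa [Real.sqrt_eq_rpow, ← Real.rpow_mul hL0.le, show -(1 / (20 * B0)) * (1 / 2 : ℝ) = -(1 / (40 * B0)) by ring] at h

end StepPars

/-! ## Uniform power bounds of size functions of the parameters -/

/-- `UBndW T S e`: as `UBnd`, for the relaxed regime `RegimeW`. [folklore] -/
def UBndW (T : ℝ) (S : StepPars → ℝ) (e : ℝ) : Prop :=
  ∃ K, 0 ≤ K ∧ ∀ ⦃P : StepPars⦄ ⦃L lam : ℝ⦄, P.Valid → P.RegimeW L lam → P.T = T → |S P| ≤ K * L ^ e

namespace UBndW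

variable {T : ℝ} {S R : StepPars → ℝ} {e e₁ e₂ e' r : ℝ}

/-- Pointwise form. [folklore] -/
theorem bnd (h : UBndW T S e) :
    ∃ K, 0 ≤ K ∧ ∀ ⦃P : StepPars⦄ ⦃L lam : ℝ⦄, P.Valid → P.RegimeW L lam → P.T = T → Bnd L (S P) K e := by
  obtain ⟨K, hK, h⟩ := h
  exact ⟨K, hK, fun _ _ _ hP hR hT => ⟨hK, h hP hR hT⟩⟩

/-- From the pointwise form. [folklore] -/
theorem of_bnd {K : ℝ} (hK : 0 ≤ K)
    (h : ∀ ⦃P : StepPars⦄ ⦃L lam : ℝ⦄, P.Valid → P.RegimeW L lam → P.T = T → Bnd L (S P) K e) : UBndW T S e :=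
  ⟨K, hK, fun _ _ _ hP hR hT => (h hP hR hT).2⟩

/-- Products. [folklore] -/
theorem mul (h₁ : UBndW T S e₁) (h₂ : UBndW T R e₂) : UBndW T (fun P => S P * R P) (e₁ + e₂) := by
  obtain ⟨K₁, hK₁, h₁⟩ := h₁.bnd
  obtain ⟨K₂, hK₂, h₂⟩ := h₂.bnd
  exact of_bnd (mul_nonneg hK₁ hK₂) fun _ _ _ hP hR hT => (h₁ hP hR hT).mul hR.hL (h₂ hP hR hT)

/-- Sums. [folklore] -/
theorem add (h₁ : UBndW T S e₁) (h₂ : UBndW T R e₂) : UBndW T (fun P => S P + R P) (max e₁ e₂) := by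
  obtain ⟨K₁, hK₁, h₁⟩ := h₁.bnd
  obtain ⟨K₂, hK₂, h₂⟩ := h₂.bnd
  exact of_bnd (add_nonneg hK₁ hK₂) fun _ _ _ hP hR hT => (h₁ hP hR hT).add hR.hL (h₂ hP hR hT)

/-- Differences. [folklore] -/
theorem sub (h₁ : UBndW T S e₁) (h₂ : UBndW T R e₂) : UBndW T (fun P => S P - R P) (max e₁ e₂) := by
  obtain ⟨K₁, hK₁, h₁⟩ := h₁.bnd
  obtain ⟨K₂, hK₂, h₂⟩ := h₂.bnd
  exact of_bnd (add_nonneg hK₁ hK₂) fun _ _ _ hP hR hT => (h₁ hP hR hT).sub hR.hL (h₂ hP hR hT)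

/-- Natural powers. [folklore] -/
theorem pow {n : ℕ} (h : UBndW T S e) : UBndW T (fun P => S P ^ n) (n * e) := by
  obtain ⟨K, hK, h⟩ := h.bnd
  exact of_bnd (pow_nonneg hK n) fun _ _ _ hP hR hT => (h hP hR hT).pow hR.hL n

/-- Real powers with nonnegative exponent. [folklore] -/
theorem rpow (h : UBndW T S e) (hr : 0 ≤ r) : UBndW T (fun P => S P ^ r) (e * r) := by
  obtain ⟨K, hK, h⟩ := h.bnd
  exact of_bnd (Real.rpow_nonneg hK r) fun _ _ _ hP hR hT => (h hP hR hT).rpow hR.hL hr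

/-- Square roots. [folklore] -/
theorem sqrt (h : UBndW T S e) : UBndW T (fun P => Real.sqrt (S P)) (e / 2) := by
  obtain ⟨K, hK, h⟩ := h.bnd
  exact of_bnd (Real.sqrt_nonneg K) fun _ _ _ hP hR hT => (h hP hR hT).sqrt hR.hL

/-- Constants. [folklore] -/
theorem const (T x : ℝ) : UBndW T (fun _ => x) 0 :=
  of_bnd (abs_nonneg x) fun _ L _ _ _ _ => Bnd.const L x

/-- Monotonicity in the exponent. [folklore] -/
theorem mono (h : UBndW T S e) (he : e ≤ e') : UBndW T S e' := by
  obtain ⟨K, hK, h⟩ := h.bnd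
  exact of_bnd hK fun _ _ _ hP hR hT => (h hP hR hT).mono hR.hL he

/-- `max 1 S`. [folklore] -/
theorem max_one (h : UBndW T S e) (he : 0 ≤ e) : UBndW T (fun P => max 1 (S P)) e := by
  obtain ⟨K, hK, h⟩ := h.bnd
  exact of_bnd (by linarith) fun _ _ _ hP hR hT => (h hP hR hT).max_one hR.hL he

/-! ### The leaves -/

/-- `σ^r`. [folklore] -/
theorem σr (T r : ℝ) : UBndW T (fun P => (P.σ : ℝ) ^ r) (3 / 16 * r) :=
  of_bnd zero_le_one fun _ _ _ _ hR _ => Bnd.rpow_eq hR.hL hR.hσ r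
/-- `κ^r`. [folklore] -/
theorem κr (T r : ℝ) : UBndW T (fun P => P.κ ^ r) (1 / 2 * r) :=
  of_bnd zero_le_one fun _ _ _ _ hR _ => Bnd.rpow_eq hR.hL hR.hκ r
/-- `μ^r`. [folklore] -/
theorem μr (T r : ℝ) : UBndW T (fun P => P.μ ^ r) (13 / 16 * r) :=
  of_bnd zero_le_one fun _ _ _ _ hR _ => Bnd.rpow_eq hR.hL hR.hμ r
/-- `σ^n`. [folklore] -/
theorem σn (T : ℝ) (n : ℕ) : UBndW T (fun P => (P.σ : ℝ) ^ n) (3 / 16 * n) :=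
  of_bnd zero_le_one fun _ _ _ _ hR _ => Bnd.npow_eq hR.hL hR.hσ n
/-- `κ^n`. [folklore] -/
theorem κn (T : ℝ) (n : ℕ) : UBndW T (fun P => P.κ ^ n) (1 / 2 * n) :=
  of_bnd zero_le_one fun _ _ _ _ hR _ => Bnd.npow_eq hR.hL hR.hκ n
/-- `μ^n`. [folklore] -/
theorem μn (T : ℝ) (n : ℕ) : UBndW T (fun P => P.μ ^ n) (13 / 16 * n) :=
  of_bnd zero_le_one fun _ _ _ _ hR _ => Bnd.npow_eq hR.hL hR.hμ n
/-- `σ`. [folklore] -/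
theorem σ (T : ℝ) : UBndW T (fun P => (P.σ : ℝ)) (3 / 16) :=
  of_bnd zero_le_one fun _ _ _ _ hR _ => Bnd.of_eq hR.hL hR.hσ
/-- `κ`. [folklore] -/
theorem κ (T : ℝ) : UBndW T (fun P => P.κ) (1 / 2) :=
  of_bnd zero_le_one fun _ _ _ _ hR _ => Bnd.of_eq hR.hL hR.hκ
/-- `μ`. [folklore] -/
theorem μ (T : ℝ) : UBndW T (fun P => P.μ) (13 / 16) :=
  of_bnd zero_le_one fun _ _ _ _ hR _ => Bnd.of_eq hR.hL hR.hμ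
/-- `μ′`. [folklore] -/
theorem mup (T : ℝ) : UBndW T (fun P => P.mup) (5 / 4) :=
  of_bnd zero_le_one fun _ _ _ _ hR _ => Bnd.of_eq hR.hL hR.hmup
/-- `σ⁻¹`. [folklore] -/
theorem σi (T : ℝ) : UBndW T (fun P => (P.σ : ℝ)⁻¹) (-(3 / 16)) :=
  of_bnd zero_le_one fun _ _ _ _ hR _ => Bnd.inv_eq hR.hL hR.hσ
/-- `κ⁻¹`. [folklore] -/
theorem κi (T : ℝ) : UBndW T (fun P => P.κ⁻¹) (-(1 / 2)) :=
  of_bnd zero_le_one fun _ _ _ _ hR _ => Bnd.inv_eq hR.hL hR.hκ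
/-- `μ⁻¹`. [folklore] -/
theorem μi (T : ℝ) : UBndW T (fun P => P.μ⁻¹) (-(13 / 16)) :=
  of_bnd zero_le_one fun _ _ _ _ hR _ => Bnd.inv_eq hR.hL hR.hμ
/-- `μ′⁻¹`. [folklore] -/
theorem mupi (T : ℝ) : UBndW T (fun P => P.mup⁻¹) (-(5 / 4)) :=
  of_bnd zero_le_one fun _ _ _ _ hR _ => Bnd.inv_eq hR.hL hR.hmup
/-- `ℓ`. [folklore] -/
theorem ℓ (T : ℝ) : UBndW T (fun P => P.ℓ) (-(1 / 16)) :=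
  of_bnd zero_le_one fun _ _ _ _ hR _ => Bnd.of_eq hR.hL hR.hℓ
/-- `Θ`. [folklore] -/
theorem Θ (T : ℝ) : UBndW T (fun P => P.Θ) (1 / 16) :=
  of_bnd zero_le_one fun _ _ _ _ hR _ => Bnd.of_eq hR.hL hR.hΘ
/-- `V`. [folklore] -/
theorem V (T : ℝ) : UBndW T (fun P => P.V) (4 / B0) :=
  of_bnd zero_le_one fun _ _ _ hP hR _ => by
    refine Bnd.of_nonneg_le (by linarith [hP.hV]) zero_le_one ?_
    rw [one_mul, hR.hV]
    exact_mod_cast hR.lam_pow_le 4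
/-- `A`. [folklore] -/
theorem A (T : ℝ) : UBndW T (fun P => P.A) (10 / B0) :=
  of_bnd zero_le_one fun _ _ _ hP hR _ => by
    refine Bnd.of_nonneg_le (by linarith [hP.hA]) zero_le_one ?_
    rw [one_mul, hR.hA]
    exact_mod_cast hR.lam_pow_le 10
/-- `γ₀`. [folklore] -/
theorem γ (T : ℝ) : UBndW T (fun P => P.γ₀) (1 / (20 * B0)) :=
  of_bnd zero_le_one fun _ _ _ hP hR _ =>
    Bnd.of_nonneg_le hP.hγ.le zero_le_one (by rw [one_mul]; exact hR.hγ1)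
/-- `δ`. [folklore] -/
theorem δ (T : ℝ) : UBndW T (fun P => P.δ) (1 / (20 * B0)) :=
  of_bnd zero_le_one fun _ _ _ hP hR _ =>
    Bnd.of_nonneg_le hP.hδ.le zero_le_one (by rw [one_mul]; exact hR.hδγ.trans hR.hγ1)
/-- `γ₀⁻¹`. [folklore] -/
theorem γi (T : ℝ) : UBndW T (fun P => P.γ₀⁻¹) (1 / (20 * B0)) :=
  of_bnd zero_le_one fun _ _ _ hP hR _ =>
    Bnd.of_nonneg_le (inv_pos.2 hP.hγ).le zero_le_one (by rw [one_mul]; exact hR.inv_γ_le hP)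
/-- `T⁻¹` (the only `T`-dependent constant). [folklore] -/
theorem Ti (T : ℝ) : UBndW T (fun P => P.T⁻¹) 0 :=
  of_bnd (abs_nonneg T⁻¹) fun _ L _ _ _ hT => by rw [hT]; exact Bnd.const L T⁻¹

/-! ### Extraction -/

/-- **The final comparison**: `S ≤ L^t` for `L ≥ L₀ = max 1 K ^ (1/m)` whenever `e + m ≤ t`,
`m > 0`. [folklore] -/
theorem le_rpow (h : UBndW T S e) {m t : ℝ} (hm : 0 < m) (het : e + m ≤ t) :
    ∃ L₀, 1 ≤ L₀ ∧ ∀ ⦃P : StepPars⦄ ⦃L lam : ℝ⦄, P.Valid → P.RegimeW L lam → P.T = T → L₀ ≤ L → S P ≤ L ^ t := by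
  obtain ⟨K, hK, h⟩ := h.bnd
  exact ⟨(max 1 K) ^ (1 / m), Bnd.one_le_threshold K hm, fun _ _ _ hP hR hT hL =>
    (h hP hR hT).le_rpow_of_le hR.hL (Bnd.const_le_rpow hm hL) het⟩

end UBndW

/-! ## The derived amplitudes -/

namespace StepPars

variable (c : StepConsts) (T : ℝ)

/-- Power counting of `Y`. [folklore] -/
theorem uYW : UBndW T (fun P => P.Y c) (201 / 400000) := by
  apply UBndW.mono
  · simp only [StepPars.Y, div_eq_mul_inv]
    apply UBndW.max_one
    · exact ((UBndW.const T c.Cp).mul (UBndW.A T)).mul (UBndW.γi T)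
    · norm_num [B0]
  · norm_num [B0]

/-- Power counting of `A₀`. [folklore] -/
theorem uA₀W : UBndW T (fun P => P.A₀ c) (101 / 400000) :=
  ((UBndW.const T c.Ca).mul ((UBndW.γ T).mul (uYW c T)).sqrt).mono (by norm_num [B0])

/-- Power counting of `A₁`. [folklore] -/
theorem uA₁W : UBndW T (fun P => P.A₁ c) (1 / 16 + 805 / 800000) :=
  ((((UBndW.const T c.Ca).mul (UBndW.γ T).sqrt).mul ((uYW c T).pow (n := 2))).mul (UBndW.Θ T)).mono (by norm_num [B0])

/-- Power counting of `A₂`. [folklore] -/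
theorem uA₂W : UBndW T (fun P => P.A₂ c) (1 / 8 + 1609 / 800000) :=
  ((((UBndW.const T c.Ca).mul (UBndW.γ T).sqrt).mul ((uYW c T).pow (n := 4))).mul ((UBndW.Θ T).pow (n := 2))).mono
    (by norm_num [B0])

/-- Power counting of `H₁`. [folklore] -/
theorem uH₁W : UBndW T (fun P => P.H₁ c) (1 / 16 + 403 / 400000) :=
  ((((UBndW.const T c.Ca).mul (UBndW.γ T)).mul ((uYW c T).pow (n := 2))).mul (UBndW.Θ T)).mono (by norm_num [B0])

/-- Power counting of `H₂`. [folklore] -/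
theorem uH₂W : UBndW T (fun P => P.H₂ c) (1 / 8 + 805 / 400000) :=
  ((((UBndW.const T c.Ca).mul (UBndW.γ T)).mul ((uYW c T).pow (n := 4))).mul ((UBndW.Θ T).pow (n := 2))).mono (by norm_num [B0])

/-! ## The sizes of the step -/

set_option maxHeartbeats 2000000 in
/-- Power counting of the new `L¹` stress. [cite: BuckmasterVicol2020, §7.7] -/
theorem uStepL1W : UBndW T (fun P => P.stepL1 c) (-(3 / 50)) := by
  apply UBndW.mono
  · simp only [StepPars.stepL1, StepPars.Ep, StepPars.Er, StepPars.Sc, StepPars.Lc, StepPars.EX, StepPars.Eζ,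
      StepPars.Z, StepPars.LS, StepPars.Lp, StepPars.LdW, StepPars.LdX, StepPars.Lf₁, StepPars.Lf₂, StepPars.Lf₃,
      Datum.wcSup, Datum.Keta, Datum.KetaD, D_σ, D_κ, D_μ, div_eq_mul_inv]
    -- structural power counting: leaves, constants, then products/sums/roots/powers
    repeat' (first
      | with_reducible exact UBndW.σr _ _ | with_reducible exact UBndW.κr _ _ | with_reducible exact UBndW.μr _ _
      | with_reducible exact UBndW.σn _ _ | with_reducible exact UBndW.κn _ _ | with_reducible exact UBndW.μn _ _
      | with_reducible exact UBndW.σ _ | with_reducible exact UBndW.κ _ | with_reducible exact UBndW.μ _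
      | with_reducible exact UBndW.mup _ | with_reducible exact UBndW.σi _ | with_reducible exact UBndW.κi _
      | with_reducible exact UBndW.μi _ | with_reducible exact UBndW.mupi _ | with_reducible exact UBndW.ℓ _
      | with_reducible exact UBndW.Θ _ | with_reducible exact UBndW.V _ | with_reducible exact UBndW.A _
      | with_reducible exact UBndW.γ _ | with_reducible exact UBndW.δ _ | with_reducible exact UBndW.γi _
      | with_reducible exact UBndW.Ti _
      | with_reducible exact uYW _ _ | with_reducible exact uA₀W _ _ | with_reducible exact uA₁W _ _
      | with_reducible exact uA₂W _ _ | with_reducible exact uH₁W _ _ | with_reducible exact uH₂W _ _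
      | with_reducible exact UBndW.const _ _
      | with_reducible apply UBndW.mul | with_reducible apply UBndW.add | with_reducible apply UBndW.sub
      | with_reducible apply UBndW.sqrt | with_reducible apply UBndW.pow | with_reducible apply UBndW.rpow
      | norm_num)
  · simp only [B0, max_le_iff]
    norm_num

set_option maxHeartbeats 2000000 in
/-- Power counting of the new sup stress. [cite: BuckmasterVicol2020, §7.7] -/
theorem uStepSupW : UBndW T (fun P => P.stepSup c) 5 := by
  apply UBndW.mono
  · simp only [StepPars.stepSup, StepPars.Sw, StepPars.Sp, StepPars.Sd, StepPars.SS, StepPars.Sf, StepPars.Φ,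
      StepPars.Lf₂, StepPars.Lf₃,
      Datum.wSup, Datum.wpSup, Datum.wcSup, Datum.XSup, Datum.zSup, Datum.dFSup, Datum.dwpcSup, Datum.dXSup,
      Datum.fastSup, Datum.dtwpcSup, D_σ, D_κ, D_μ, D_mup, div_eq_mul_inv]
    -- structural power counting: leaves, constants, then products/sums/roots/powers
    repeat' (first
      | with_reducible exact UBndW.σr _ _ | with_reducible exact UBndW.κr _ _ | with_reducible exact UBndW.μr _ _
      | with_reducible exact UBndW.σn _ _ | with_reducible exact UBndW.κn _ _ | with_reducible exact UBndW.μn _ _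
      | with_reducible exact UBndW.σ _ | with_reducible exact UBndW.κ _ | with_reducible exact UBndW.μ _
      | with_reducible exact UBndW.mup _ | with_reducible exact UBndW.σi _ | with_reducible exact UBndW.κi _
      | with_reducible exact UBndW.μi _ | with_reducible exact UBndW.mupi _ | with_reducible exact UBndW.ℓ _
      | with_reducible exact UBndW.Θ _ | with_reducible exact UBndW.V _ | with_reducible exact UBndW.A _
      | with_reducible exact UBndW.γ _ | with_reducible exact UBndW.δ _ | with_reducible exact UBndW.γi _
      | with_reducible exact UBndW.Ti _
      | with_reducible exact uYW _ _ | with_reducible exact uA₀W _ _ | with_reducible exact uA₁W _ _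
      | with_reducible exact uA₂W _ _ | with_reducible exact uH₁W _ _ | with_reducible exact uH₂W _ _
      | with_reducible exact UBndW.const _ _
      | with_reducible apply UBndW.mul | with_reducible apply UBndW.add | with_reducible apply UBndW.sub
      | with_reducible apply UBndW.sqrt | with_reducible apply UBndW.pow)
  · simp only [B0, max_le_iff]
    norm_num

set_option maxHeartbeats 2000000 in
/-- Power counting of the `C¹` size of the new velocity. [cite: BuckmasterVicol2020, §7.7] -/
theorem uStepC1W : UBndW T (fun P => P.stepC0 c + 3 * P.stepC1 c + P.stepCt c) (31 / 8) := by
  apply UBndW.mono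
  · simp only [StepPars.stepC0, StepPars.stepC1, StepPars.stepCt, StepPars.Sw,
      Datum.wSup, Datum.wpSup, Datum.wcSup, Datum.XSup, Datum.zSup, Datum.dFSup, Datum.dwSup, Datum.dwpcSup,
      Datum.dXSup, Datum.zzSup, Datum.ddFSup, Datum.fastSup, Datum.dfastSup, Datum.ddfastSup, Datum.dtwSup,
      Datum.dtwpcSup, Datum.dtXSup, Datum.FdotSup, Datum.zdotSup, Datum.dFdotSup, Datum.ddirSup,
      D_σ, D_κ, D_μ, D_mup, div_eq_mul_inv]
    -- structural power counting: leaves, constants, then products/sums/roots/powers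
    repeat' (first
      | with_reducible exact UBndW.σr _ _ | with_reducible exact UBndW.κr _ _ | with_reducible exact UBndW.μr _ _
      | with_reducible exact UBndW.σn _ _ | with_reducible exact UBndW.κn _ _ | with_reducible exact UBndW.μn _ _
      | with_reducible exact UBndW.σ _ | with_reducible exact UBndW.κ _ | with_reducible exact UBndW.μ _
      | with_reducible exact UBndW.mup _ | with_reducible exact UBndW.σi _ | with_reducible exact UBndW.κi _
      | with_reducible exact UBndW.μi _ | with_reducible exact UBndW.mupi _ | with_reducible exact UBndW.ℓ _
      | with_reducible exact UBndW.Θ _ | with_reducible exact UBndW.V _ | with_reducible exact UBndW.A _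
      | with_reducible exact UBndW.γ _ | with_reducible exact UBndW.δ _ | with_reducible exact UBndW.γi _
      | with_reducible exact UBndW.Ti _
      | with_reducible exact uYW _ _ | with_reducible exact uA₀W _ _ | with_reducible exact uA₁W _ _
      | with_reducible exact uA₂W _ _ | with_reducible exact uH₁W _ _ | with_reducible exact uH₂W _ _
      | with_reducible exact UBndW.const _ _
      | with_reducible apply UBndW.mul | with_reducible apply UBndW.add | with_reducible apply UBndW.sub
      | with_reducible apply UBndW.sqrt | with_reducible apply UBndW.pow)
  · simp only [B0, max_le_iff]
    norm_num

/-- Power counting of the mollification part of the `L²` increment. [cite: BuckmasterVicol2020, §7.7] -/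
theorem uIncAW : UBndW T (fun P => c.Cp * (P.V + P.V) * P.ℓ) (-(1 / 20)) :=
  (((UBndW.const T c.Cp).mul ((UBndW.V T).add (UBndW.V T))).mul (UBndW.ℓ T)).mono (by norm_num [B0])

set_option maxHeartbeats 2000000 in
/-- Power counting of the corrector energy. [cite: BuckmasterVicol2020, §7.7] -/
theorem uErW : UBndW T (fun P => P.Er c) (-(1 / 4)) := by
  apply UBndW.mono
  · simp only [StepPars.Er, StepPars.Sc, StepPars.Lc, StepPars.EX, StepPars.Eζ, StepPars.Z, Datum.wcSup,
      D_σ, D_κ, div_eq_mul_inv]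
    -- structural power counting: leaves, constants, then products/sums/roots/powers
    repeat' (first
      | with_reducible exact UBndW.σr _ _ | with_reducible exact UBndW.κr _ _ | with_reducible exact UBndW.μr _ _
      | with_reducible exact UBndW.σn _ _ | with_reducible exact UBndW.κn _ _ | with_reducible exact UBndW.μn _ _
      | with_reducible exact UBndW.σ _ | with_reducible exact UBndW.κ _ | with_reducible exact UBndW.μ _
      | with_reducible exact UBndW.mup _ | with_reducible exact UBndW.σi _ | with_reducible exact UBndW.κi _
      | with_reducible exact UBndW.μi _ | with_reducible exact UBndW.mupi _ | with_reducible exact UBndW.ℓ _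
      | with_reducible exact UBndW.Θ _ | with_reducible exact UBndW.V _ | with_reducible exact UBndW.A _
      | with_reducible exact UBndW.γ _ | with_reducible exact UBndW.δ _ | with_reducible exact UBndW.γi _
      | with_reducible exact UBndW.Ti _
      | with_reducible exact uYW _ _ | with_reducible exact uA₀W _ _ | with_reducible exact uA₁W _ _
      | with_reducible exact uA₂W _ _ | with_reducible exact uH₁W _ _ | with_reducible exact uH₂W _ _
      | with_reducible exact UBndW.const _ _
      | with_reducible apply UBndW.mul | with_reducible apply UBndW.add | with_reducible apply UBndW.sub
      | with_reducible apply UBndW.sqrt | with_reducible apply UBndW.pow)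
  · norm_num [max_le_iff]

/-- Power counting of the corrector part of the `L²` increment. [cite: BuckmasterVicol2020, §7.7] -/
theorem uIncCW : UBndW T (fun P => Real.sqrt (P.Er c)) (-(1 / 8)) :=
  (uErW c T).sqrt.mono (by norm_num)


/-! ## The additional sizes of the weighted step -/

set_option maxHeartbeats 2000000 in
/-- Power counting of the cut-off term of the `L¹` stress. [cite: BuckmasterVicol2019Annals, §7] -/
theorem uExtraL1W : UBndW T (fun P => c.C₁ * (P.Lp c + P.Lc c + 2 * Real.sqrt (P.EX c))) (-(3 / 16) + 1 / 1000) := by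
  apply UBndW.mono
  · simp only [StepPars.Lp, StepPars.Lc, StepPars.EX, div_eq_mul_inv]
    repeat' (first
      | with_reducible exact UBndW.σr _ _ | with_reducible exact UBndW.κr _ _ | with_reducible exact UBndW.μr _ _
      | with_reducible exact UBndW.σn _ _ | with_reducible exact UBndW.κn _ _ | with_reducible exact UBndW.μn _ _
      | with_reducible exact UBndW.σ _ | with_reducible exact UBndW.κ _ | with_reducible exact UBndW.μ _
      | with_reducible exact UBndW.mup _ | with_reducible exact UBndW.σi _ | with_reducible exact UBndW.κi _
      | with_reducible exact UBndW.μi _ | with_reducible exact UBndW.mupi _ | with_reducible exact UBndW.ℓ _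
      | with_reducible exact UBndW.Θ _ | with_reducible exact UBndW.V _ | with_reducible exact UBndW.A _
      | with_reducible exact UBndW.γ _ | with_reducible exact UBndW.δ _ | with_reducible exact UBndW.γi _
      | with_reducible exact UBndW.Ti _
      | with_reducible exact uYW _ _ | with_reducible exact uA₀W _ _ | with_reducible exact uA₁W _ _
      | with_reducible exact uA₂W _ _ | with_reducible exact uH₁W _ _ | with_reducible exact uH₂W _ _
      | with_reducible exact UBndW.const _ _
      | with_reducible apply UBndW.mul | with_reducible apply UBndW.add | with_reducible apply UBndW.sub
      | with_reducible apply UBndW.sqrt | with_reducible apply UBndW.pow)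
  · norm_num [B0, max_le_iff]

set_option maxHeartbeats 2000000 in
/-- Power counting of the cut-off term of the sup stress. [cite: BuckmasterVicol2019Annals, §7] -/
theorem uExtraSupW : UBndW T (fun P => c.Kℛ * (P.Sp c + P.Sc c + 2 * P.D.XSup (P.A₀ c) c.B)) (17 / 16 + 1 / 1000) := by
  apply UBndW.mono
  · simp only [StepPars.Sp, StepPars.Sc, Datum.wpSup, Datum.wcSup, Datum.XSup, D_σ, D_κ, D_μ, D_mup, div_eq_mul_inv]
    repeat' (first
      | with_reducible exact UBndW.σr _ _ | with_reducible exact UBndW.κr _ _ | with_reducible exact UBndW.μr _ _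
      | with_reducible exact UBndW.σn _ _ | with_reducible exact UBndW.κn _ _ | with_reducible exact UBndW.μn _ _
      | with_reducible exact UBndW.σ _ | with_reducible exact UBndW.κ _ | with_reducible exact UBndW.μ _
      | with_reducible exact UBndW.mup _ | with_reducible exact UBndW.σi _ | with_reducible exact UBndW.κi _
      | with_reducible exact UBndW.μi _ | with_reducible exact UBndW.mupi _ | with_reducible exact UBndW.ℓ _
      | with_reducible exact UBndW.Θ _ | with_reducible exact UBndW.V _ | with_reducible exact UBndW.A _
      | with_reducible exact UBndW.γ _ | with_reducible exact UBndW.δ _ | with_reducible exact UBndW.γi _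
      | with_reducible exact UBndW.Ti _
      | with_reducible exact uYW _ _ | with_reducible exact uA₀W _ _ | with_reducible exact uA₁W _ _
      | with_reducible exact uA₂W _ _ | with_reducible exact uH₁W _ _ | with_reducible exact uH₂W _ _
      | with_reducible exact UBndW.const _ _
      | with_reducible apply UBndW.mul | with_reducible apply UBndW.add | with_reducible apply UBndW.sub
      | with_reducible apply UBndW.sqrt | with_reducible apply UBndW.pow)
  · norm_num [B0, max_le_iff]

set_option maxHeartbeats 2000000 in
/-- Power counting of `sup‖w̃‖`. [cite: BuckmasterVicol2020, §7.7] -/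
theorem uSwW : UBndW T (fun P => P.Sw c) (15 / 8 + 1 / 1000) := by
  apply UBndW.mono
  · simp only [StepPars.Sw, Datum.wSup, Datum.wpSup, Datum.wcSup, Datum.XSup, Datum.zSup, Datum.dFSup,
      D_σ, D_κ, D_μ, D_mup, div_eq_mul_inv]
    repeat' (first
      | with_reducible exact UBndW.σr _ _ | with_reducible exact UBndW.κr _ _ | with_reducible exact UBndW.μr _ _
      | with_reducible exact UBndW.σn _ _ | with_reducible exact UBndW.κn _ _ | with_reducible exact UBndW.μn _ _
      | with_reducible exact UBndW.σ _ | with_reducible exact UBndW.κ _ | with_reducible exact UBndW.μ _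
      | with_reducible exact UBndW.mup _ | with_reducible exact UBndW.σi _ | with_reducible exact UBndW.κi _
      | with_reducible exact UBndW.μi _ | with_reducible exact UBndW.mupi _ | with_reducible exact UBndW.ℓ _
      | with_reducible exact UBndW.Θ _ | with_reducible exact UBndW.V _ | with_reducible exact UBndW.A _
      | with_reducible exact UBndW.γ _ | with_reducible exact UBndW.δ _ | with_reducible exact UBndW.γi _
      | with_reducible exact UBndW.Ti _
      | with_reducible exact uYW _ _ | with_reducible exact uA₀W _ _ | with_reducible exact uA₁W _ _
      | with_reducible exact uA₂W _ _ | with_reducible exact uH₁W _ _ | with_reducible exact uH₂W _ _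
      | with_reducible exact UBndW.const _ _
      | with_reducible apply UBndW.mul | with_reducible apply UBndW.add | with_reducible apply UBndW.sub
      | with_reducible apply UBndW.sqrt | with_reducible apply UBndW.pow)
  · norm_num [B0, max_le_iff]

set_option maxHeartbeats 2000000 in
/-- Power counting of `sup‖v'‖`. [cite: BuckmasterVicol2020, §7.7] -/
theorem uStepC0W : UBndW T (fun P => P.stepC0 c) (15 / 8 + 1 / 1000) := by
  apply UBndW.mono
  · simp only [StepPars.stepC0, StepPars.Sw, Datum.wSup, Datum.wpSup, Datum.wcSup, Datum.XSup, Datum.zSup, Datum.dFSup,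
      D_σ, D_κ, D_μ, D_mup, div_eq_mul_inv]
    repeat' (first
      | with_reducible exact UBndW.σr _ _ | with_reducible exact UBndW.κr _ _ | with_reducible exact UBndW.μr _ _
      | with_reducible exact UBndW.σn _ _ | with_reducible exact UBndW.κn _ _ | with_reducible exact UBndW.μn _ _
      | with_reducible exact UBndW.σ _ | with_reducible exact UBndW.κ _ | with_reducible exact UBndW.μ _
      | with_reducible exact UBndW.mup _ | with_reducible exact UBndW.σi _ | with_reducible exact UBndW.κi _
      | with_reducible exact UBndW.μi _ | with_reducible exact UBndW.mupi _ | with_reducible exact UBndW.ℓ _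
      | with_reducible exact UBndW.Θ _ | with_reducible exact UBndW.V _ | with_reducible exact UBndW.A _
      | with_reducible exact UBndW.γ _ | with_reducible exact UBndW.δ _ | with_reducible exact UBndW.γi _
      | with_reducible exact UBndW.Ti _
      | with_reducible exact uYW _ _ | with_reducible exact uA₀W _ _ | with_reducible exact uA₁W _ _
      | with_reducible exact uA₂W _ _ | with_reducible exact uH₁W _ _ | with_reducible exact uH₂W _ _
      | with_reducible exact UBndW.const _ _
      | with_reducible apply UBndW.mul | with_reducible apply UBndW.add | with_reducible apply UBndW.sub
      | with_reducible apply UBndW.sqrt | with_reducible apply UBndW.pow)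
  · norm_num [B0, max_le_iff]

set_option maxHeartbeats 2000000 in
/-- Power counting of `sup‖∂ᵢv'‖`. [cite: BuckmasterVicol2020, §7.7] -/
theorem uStepC1W' : UBndW T (fun P => P.stepC1 c) (31 / 8) := by
  apply UBndW.mono
  · simp only [StepPars.stepC1, Datum.dFSup, Datum.dwSup, Datum.dwpcSup,
      Datum.dXSup, Datum.zzSup, Datum.ddFSup, Datum.fastSup, Datum.dfastSup, Datum.ddfastSup,
      D_σ, D_κ, D_μ, D_mup, div_eq_mul_inv]
    repeat' (first
      | with_reducible exact UBndW.σr _ _ | with_reducible exact UBndW.κr _ _ | with_reducible exact UBndW.μr _ _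
      | with_reducible exact UBndW.σn _ _ | with_reducible exact UBndW.κn _ _ | with_reducible exact UBndW.μn _ _
      | with_reducible exact UBndW.σ _ | with_reducible exact UBndW.κ _ | with_reducible exact UBndW.μ _
      | with_reducible exact UBndW.mup _ | with_reducible exact UBndW.σi _ | with_reducible exact UBndW.κi _
      | with_reducible exact UBndW.μi _ | with_reducible exact UBndW.mupi _ | with_reducible exact UBndW.ℓ _
      | with_reducible exact UBndW.Θ _ | with_reducible exact UBndW.V _ | with_reducible exact UBndW.A _
      | with_reducible exact UBndW.γ _ | with_reducible exact UBndW.δ _ | with_reducible exact UBndW.γi _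
      | with_reducible exact UBndW.Ti _
      | with_reducible exact uYW _ _ | with_reducible exact uA₀W _ _ | with_reducible exact uA₁W _ _
      | with_reducible exact uA₂W _ _ | with_reducible exact uH₁W _ _ | with_reducible exact uH₂W _ _
      | with_reducible exact UBndW.const _ _
      | with_reducible apply UBndW.mul | with_reducible apply UBndW.add | with_reducible apply UBndW.sub
      | with_reducible apply UBndW.sqrt | with_reducible apply UBndW.pow)
  · norm_num [B0, max_le_iff]

set_option maxHeartbeats 2000000 in
/-- Power counting of `sup‖∂ₜv'‖`. [cite: BuckmasterVicol2020, §7.7] -/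
theorem uStepCtW : UBndW T (fun P => P.stepCt c) (31 / 8) := by
  apply UBndW.mono
  · simp only [StepPars.stepCt, Datum.fastSup, Datum.dfastSup, Datum.dtwSup,
      Datum.dtwpcSup, Datum.dtXSup, Datum.FdotSup, Datum.zdotSup, Datum.dFdotSup, Datum.ddirSup,
      D_σ, D_κ, D_μ, D_mup, div_eq_mul_inv]
    repeat' (first
      | with_reducible exact UBndW.σr _ _ | with_reducible exact UBndW.κr _ _ | with_reducible exact UBndW.μr _ _
      | with_reducible exact UBndW.σn _ _ | with_reducible exact UBndW.κn _ _ | with_reducible exact UBndW.μn _ _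
      | with_reducible exact UBndW.σ _ | with_reducible exact UBndW.κ _ | with_reducible exact UBndW.μ _
      | with_reducible exact UBndW.mup _ | with_reducible exact UBndW.σi _ | with_reducible exact UBndW.κi _
      | with_reducible exact UBndW.μi _ | with_reducible exact UBndW.mupi _ | with_reducible exact UBndW.ℓ _
      | with_reducible exact UBndW.Θ _ | with_reducible exact UBndW.V _ | with_reducible exact UBndW.A _
      | with_reducible exact UBndW.γ _ | with_reducible exact UBndW.δ _ | with_reducible exact UBndW.γi _
      | with_reducible exact UBndW.Ti _
      | with_reducible exact uYW _ _ | with_reducible exact uA₀W _ _ | with_reducible exact uA₁W _ _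
      | with_reducible exact uA₂W _ _ | with_reducible exact uH₁W _ _ | with_reducible exact uH₂W _ _
      | with_reducible exact UBndW.const _ _
      | with_reducible apply UBndW.mul | with_reducible apply UBndW.add | with_reducible apply UBndW.sub
      | with_reducible apply UBndW.sqrt | with_reducible apply UBndW.pow)
  · norm_num [B0, max_le_iff]

set_option maxHeartbeats 2000000 in
/-- Power counting of the linear energy error `2V ∫‖w̃‖`. [cite: BuckmasterVicol2019Annals, §7] -/
theorem uErrLinW : UBndW T (fun P => 2 * P.V * (P.Lp c + P.Lc c + Real.sqrt (P.EX c) + Real.sqrt (P.Eζ c))) (-(3 / 16) + 1 / 500) := by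
  apply UBndW.mono
  · simp only [StepPars.Lp, StepPars.Lc, StepPars.EX, StepPars.Eζ, StepPars.Z, div_eq_mul_inv]
    repeat' (first
      | with_reducible exact UBndW.σr _ _ | with_reducible exact UBndW.κr _ _ | with_reducible exact UBndW.μr _ _
      | with_reducible exact UBndW.σn _ _ | with_reducible exact UBndW.κn _ _ | with_reducible exact UBndW.μn _ _
      | with_reducible exact UBndW.σ _ | with_reducible exact UBndW.κ _ | with_reducible exact UBndW.μ _
      | with_reducible exact UBndW.mup _ | with_reducible exact UBndW.σi _ | with_reducible exact UBndW.κi _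
      | with_reducible exact UBndW.μi _ | with_reducible exact UBndW.mupi _ | with_reducible exact UBndW.ℓ _
      | with_reducible exact UBndW.Θ _ | with_reducible exact UBndW.V _ | with_reducible exact UBndW.A _
      | with_reducible exact UBndW.γ _ | with_reducible exact UBndW.δ _ | with_reducible exact UBndW.γi _
      | with_reducible exact UBndW.Ti _
      | with_reducible exact uYW _ _ | with_reducible exact uA₀W _ _ | with_reducible exact uA₁W _ _
      | with_reducible exact uA₂W _ _ | with_reducible exact uH₁W _ _ | with_reducible exact uH₂W _ _
      | with_reducible exact UBndW.const _ _
      | with_reducible apply UBndW.mul | with_reducible apply UBndW.add | with_reducible apply UBndW.sub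
      | with_reducible apply UBndW.sqrt | with_reducible apply UBndW.pow)
  · norm_num [B0, max_le_iff]

set_option maxHeartbeats 2000000 in
/-- Power counting of the oscillation energy error `15 N H₁ √3 σ⁻¹`. [cite: BuckmasterVicol2019Annals, §7] -/
theorem uErrOscW : UBndW T (fun P => NN * (5 * (3 * P.H₁ c * (Real.sqrt 3 / P.σ)))) (-(1 / 8) + 1 / 500) := by
  apply UBndW.mono
  · simp only [div_eq_mul_inv]
    repeat' (first
      | with_reducible exact UBndW.σr _ _ | with_reducible exact UBndW.κr _ _ | with_reducible exact UBndW.μr _ _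
      | with_reducible exact UBndW.σn _ _ | with_reducible exact UBndW.κn _ _ | with_reducible exact UBndW.μn _ _
      | with_reducible exact UBndW.σ _ | with_reducible exact UBndW.κ _ | with_reducible exact UBndW.μ _
      | with_reducible exact UBndW.mup _ | with_reducible exact UBndW.σi _ | with_reducible exact UBndW.κi _
      | with_reducible exact UBndW.μi _ | with_reducible exact UBndW.mupi _ | with_reducible exact UBndW.ℓ _
      | with_reducible exact UBndW.Θ _ | with_reducible exact UBndW.V _ | with_reducible exact UBndW.A _
      | with_reducible exact UBndW.γ _ | with_reducible exact UBndW.δ _ | with_reducible exact UBndW.γi _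
      | with_reducible exact UBndW.Ti _
      | with_reducible exact uYW _ _ | with_reducible exact uA₀W _ _ | with_reducible exact uA₁W _ _
      | with_reducible exact uA₂W _ _ | with_reducible exact uH₁W _ _ | with_reducible exact uH₂W _ _
      | with_reducible exact UBndW.const _ _
      | with_reducible apply UBndW.mul
     
     )
  · norm_num [B0, max_le_iff]

/-! ## The principal part of the `L²` increment -/

variable {c T} {P : StepPars} {L lam : ℝ}

/-- `Y² Θ σ⁻¹ ≤ (1 + C_p)²` in the regime. [folklore] -/
theorem Y_sq_Θ_div_σ_leW (hc : c.Valid) (hP : P.Valid) (hR : P.RegimeW L lam) :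
    P.Y c ^ 2 * P.Θ * (P.σ : ℝ)⁻¹ ≤ (1 + c.Cp) ^ 2 := by
  have hL := hR.hL
  have hL0 : 0 < L := by linarith
  have hCp : 0 ≤ c.Cp := by linarith [hc.hCp]
  have hγ := hP.hγ
  -- `Y ≤ (1 + C_p) L^{y}`
  have hy : P.Y c ≤ (1 + c.Cp) * L ^ (201 / 400000 : ℝ) := by
    have h1 : c.Cp * P.A / P.γ₀ ≤ c.Cp * L ^ (201 / 400000 : ℝ) := by
      rw [div_eq_mul_inv, mul_assoc]
      refine mul_le_mul_of_nonneg_left ?_ hCp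
      have hA : P.A ≤ L ^ ((10 : ℝ) / B0) := by rw [hR.hA]; exact_mod_cast hR.lam_pow_le 10
      have hγi := hR.inv_γ_le hP
      calc P.A * P.γ₀⁻¹ ≤ L ^ ((10 : ℝ) / B0) * L ^ (1 / (20 * B0)) :=
            mul_le_mul hA hγi (inv_pos.2 hγ).le (Real.rpow_nonneg hL0.le _)
        _ = L ^ (201 / 400000 : ℝ) := by rw [← Real.rpow_add hL0]; norm_num [B0]
    have h2 : 1 ≤ L ^ (201 / 400000 : ℝ) := Real.one_le_rpow hL (by norm_num)
    refine max_le (by nlinarith) (h1.trans ?_)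
    nlinarith
  have hY0 : 0 ≤ P.Y c := le_trans zero_le_one (le_max_left _ _)
  have hY2 : P.Y c ^ 2 ≤ (1 + c.Cp) ^ 2 * L ^ (201 / 200000 : ℝ) := by
    calc P.Y c ^ 2 ≤ ((1 + c.Cp) * L ^ (201 / 400000 : ℝ)) ^ 2 := pow_le_pow_left₀ hY0 hy 2
      _ = (1 + c.Cp) ^ 2 * L ^ (201 / 200000 : ℝ) := by
          rw [mul_pow, ← Real.rpow_natCast (L ^ (201 / 400000 : ℝ)) 2, ← Real.rpow_mul hL0.le]; norm_num
  have hΘσ : P.Θ * (P.σ : ℝ)⁻¹ = L ^ (-(1 / 8 : ℝ)) := by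
    rw [hR.hΘ, hR.hσ, ← Real.rpow_neg hL0.le, ← Real.rpow_add hL0]; norm_num
  have hneg : L ^ (201 / 200000 : ℝ) * L ^ (-(1 / 8 : ℝ)) ≤ 1 := by
    rw [← Real.rpow_add hL0]
    exact Real.rpow_le_one_of_one_le_of_nonpos hL (by norm_num)
  calc P.Y c ^ 2 * P.Θ * (P.σ : ℝ)⁻¹ = P.Y c ^ 2 * (P.Θ * (P.σ : ℝ)⁻¹) := by ring
    _ ≤ (1 + c.Cp) ^ 2 * L ^ (201 / 200000 : ℝ) * L ^ (-(1 / 8 : ℝ)) := by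
        rw [hΘσ]; exact mul_le_mul_of_nonneg_right hY2 (Real.rpow_nonneg hL0.le _)
    _ = (1 + c.Cp) ^ 2 * (L ^ (201 / 200000 : ℝ) * L ^ (-(1 / 8 : ℝ))) := by ring
    _ ≤ (1 + c.Cp) ^ 2 := mul_le_of_le_one_right (by positivity) hneg

/-- **`√Ep ≤ M₁ √γ₀`**: the principal part of the `L²` increment (2.8). [cite: BuckmasterVicol2019Annals, (2.8)] -/
theorem sqrt_Ep_leW (hc : c.Valid) (hP : P.Valid) (hR : P.RegimeW L lam) :
    Real.sqrt (P.Ep c) ≤ M₁ c * Real.sqrt P.γ₀ := by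
  have hCp : 0 ≤ c.Cp := by linarith [hc.hCp]
  have hCa := hc.hCa
  have hγ := hP.hγ
  have hr : 0 < radius (Fin 3) := radius_pos Datum.hd3
  have hN : 0 ≤ NN := le_trans zero_le_one one_le_NN
  have key := Y_sq_Θ_div_σ_leW hc hP hR
  have h1 : P.γ₀ + 3 * (c.Cp * P.δ) ≤ (1 + 3 * c.Cp) * P.γ₀ := by
    have := hR.hδγ; nlinarith
  have h2 : 3 * P.H₁ c * (Real.sqrt 3 / P.σ) ≤ 3 * (c.Ca * (1 + c.Cp) ^ 2) * Real.sqrt 3 * P.γ₀ := by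
    have e : 3 * P.H₁ c * (Real.sqrt 3 / P.σ) = 3 * (c.Ca * (P.Y c ^ 2 * P.Θ * (P.σ : ℝ)⁻¹)) * Real.sqrt 3 * P.γ₀ := by
      simp only [StepPars.H₁, div_eq_mul_inv]; ring
    rw [e]
    have h3 : 0 ≤ Real.sqrt 3 := Real.sqrt_nonneg 3
    have : c.Ca * (P.Y c ^ 2 * P.Θ * (P.σ : ℝ)⁻¹) ≤ c.Ca * (1 + c.Cp) ^ 2 := mul_le_mul_of_nonneg_left key hCa
    have : 3 * (c.Ca * (P.Y c ^ 2 * P.Θ * (P.σ : ℝ)⁻¹)) * Real.sqrt 3 ≤ 3 * (c.Ca * (1 + c.Cp) ^ 2) * Real.sqrt 3 := by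
      nlinarith
    exact mul_le_mul_of_nonneg_right this hγ.le
  have hEp : P.Ep c ≤ M₁ c ^ 2 * P.γ₀ := by
    have e : M₁ c ^ 2 * P.γ₀ = NN * (5 * (2 / radius (Fin 3) * ((1 + 3 * c.Cp) * P.γ₀) + 3 * (c.Ca * (1 + c.Cp) ^ 2) * Real.sqrt 3 * P.γ₀)) := by
      unfold M₁
      rw [Real.sq_sqrt (by positivity)]
      ring
    rw [e]
    unfold StepPars.Ep
    have hr2 : 0 ≤ 2 / radius (Fin 3) := by positivity
    have := mul_le_mul_of_nonneg_left h1 hr2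
    nlinarith
  calc Real.sqrt (P.Ep c) ≤ Real.sqrt (M₁ c ^ 2 * P.γ₀) := Real.sqrt_le_sqrt hEp
    _ = M₁ c * Real.sqrt P.γ₀ := by rw [Real.sqrt_mul (sq_nonneg _), Real.sqrt_sq (by unfold M₁; positivity)]


/-! ## The parameter choice: the bounds of the weighted step -/

/-- `x ≤` an iterated `max`. [folklore] -/
private theorem le_of_max_le {x y L : ℝ} (h : max x y ≤ L) : x ≤ L ∧ y ≤ L := max_le_iff.1 h

/-- **The arithmetic of the weighted step.** For admissible constants there is an absolute `M > 0`,
and for every time horizon `T` a threshold `L₀`, such that in the relaxed regime at frequency `L ≥ L₀`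
the sizes produced by `JetStep.jet_step_weighted` obey: `√E_p ≤ M√γ₀` (principal `L²` increment),
`L¹` stress `≤ L^{-11/200}`, cut-off `L¹` term `≤ L^{-1/8}`, sup stress `≤ L⁶`, cut-off sup term `≤ L²`,
`sup‖v'‖, sup‖w̃‖ ≤ L²`, `sup‖∂v'‖, sup‖∂ₜv'‖ ≤ L⁴`, energy errors `≤ L^{-1/8}, L^{-1/5}, L^{-1/10}, L^{-1/10}`.
[cite: BuckmasterVicol2019Annals, §2.1–2.3, §7; BuckmasterVicol2020, §7.7] -/
theorem step_arith_weighted (hc : c.Valid) : ∃ M : ℝ, 0 < M ∧ ∀ T : ℝ, ∃ L₀ : ℝ, 1 ≤ L₀ ∧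
    ∀ ⦃P : StepPars⦄ ⦃L lam : ℝ⦄, P.Valid → P.RegimeW L lam → P.T = T → L₀ ≤ L →
      Real.sqrt (P.Ep c) ≤ M * Real.sqrt P.γ₀ ∧
      P.stepL1 c ≤ L ^ (-(11 / 200 : ℝ)) ∧
      c.C₁ * (P.Lp c + P.Lc c + 2 * Real.sqrt (P.EX c)) ≤ L ^ (-(1 / 8 : ℝ)) ∧
      P.stepSup c ≤ L ^ (6 : ℝ) ∧
      c.Kℛ * (P.Sp c + P.Sc c + 2 * P.D.XSup (P.A₀ c) c.B) ≤ L ^ (2 : ℝ) ∧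
      P.stepC0 c ≤ L ^ (2 : ℝ) ∧ P.stepC1 c ≤ L ^ (4 : ℝ) ∧ P.stepCt c ≤ L ^ (4 : ℝ) ∧ P.Sw c ≤ L ^ (2 : ℝ) ∧
      2 * P.V * (P.Lp c + P.Lc c + Real.sqrt (P.EX c) + Real.sqrt (P.Eζ c)) ≤ L ^ (-(1 / 8 : ℝ)) ∧
      P.Er c ≤ L ^ (-(1 / 5 : ℝ)) ∧ Real.sqrt (P.Er c) ≤ L ^ (-(1 / 10 : ℝ)) ∧
      NN * (5 * (3 * P.H₁ c * (Real.sqrt 3 / P.σ))) ≤ L ^ (-(1 / 10 : ℝ)) := by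
  have hM₁ : 0 ≤ M₁ c := Real.sqrt_nonneg _
  refine ⟨1 + M₁ c, by linarith, fun T => ?_⟩
  obtain ⟨L₁, hL₁, h₁⟩ := (uStepL1W c T).le_rpow (m := 1 / 200) (t := -(11 / 200)) (by norm_num) (by norm_num)
  obtain ⟨L₂, hL₂, h₂⟩ := (uExtraL1W c T).le_rpow (m := 1 / 20) (t := -(1 / 8)) (by norm_num) (by norm_num)
  obtain ⟨L₃, hL₃, h₃⟩ := (uStepSupW c T).le_rpow (m := 1) (t := 6) (by norm_num) (by norm_num)
  obtain ⟨L₄, hL₄, h₄⟩ := (uExtraSupW c T).le_rpow (m := 1 / 2) (t := 2) (by norm_num) (by norm_num)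
  obtain ⟨L₅, hL₅, h₅⟩ := (uStepC0W c T).le_rpow (m := 1 / 10) (t := 2) (by norm_num) (by norm_num)
  obtain ⟨L₆, hL₆, h₆⟩ := (uStepC1W' c T).le_rpow (m := 1 / 8) (t := 4) (by norm_num) (by norm_num)
  obtain ⟨L₇, hL₇, h₇⟩ := (uStepCtW c T).le_rpow (m := 1 / 8) (t := 4) (by norm_num) (by norm_num)
  obtain ⟨L₈, hL₈, h₈⟩ := (uSwW c T).le_rpow (m := 1 / 10) (t := 2) (by norm_num) (by norm_num)
  obtain ⟨L₉, hL₉, h₉⟩ := (uErrLinW c T).le_rpow (m := 1 / 20) (t := -(1 / 8)) (by norm_num) (by norm_num)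
  obtain ⟨L₁₀, hL₁₀, h₁₀⟩ := (uErW c T).le_rpow (m := 1 / 20) (t := -(1 / 5)) (by norm_num) (by norm_num)
  obtain ⟨L₁₁, hL₁₁, h₁₁⟩ := (uIncCW c T).le_rpow (m := 1 / 40) (t := -(1 / 10)) (by norm_num) (by norm_num)
  obtain ⟨L₁₂, hL₁₂, h₁₂⟩ := (uErrOscW c T).le_rpow (m := 1 / 50) (t := -(1 / 10)) (by norm_num) (by norm_num)
  refine ⟨max L₁ (max L₂ (max L₃ (max L₄ (max L₅ (max L₆ (max L₇ (max L₈ (max L₉ (max L₁₀ (max L₁₁ L₁₂)))))))))),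
    le_max_of_le_left hL₁, fun P L _ hP hR hT hL => ?_⟩
  obtain ⟨e₁, hL⟩ := le_of_max_le hL
  obtain ⟨e₂, hL⟩ := le_of_max_le hL
  obtain ⟨e₃, hL⟩ := le_of_max_le hL
  obtain ⟨e₄, hL⟩ := le_of_max_le hL
  obtain ⟨e₅, hL⟩ := le_of_max_le hL
  obtain ⟨e₆, hL⟩ := le_of_max_le hL
  obtain ⟨e₇, hL⟩ := le_of_max_le hL
  obtain ⟨e₈, hL⟩ := le_of_max_le hL
  obtain ⟨e₉, hL⟩ := le_of_max_le hL
  obtain ⟨e₁₀, hL⟩ := le_of_max_le hL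
  obtain ⟨e₁₁, e₁₂⟩ := le_of_max_le hL
  refine ⟨?_, h₁ hP hR hT e₁, h₂ hP hR hT e₂, h₃ hP hR hT e₃, h₄ hP hR hT e₄, h₅ hP hR hT e₅, h₆ hP hR hT e₆, h₇ hP hR hT e₇,
    h₈ hP hR hT e₈, h₉ hP hR hT e₉, h₁₀ hP hR hT e₁₀, h₁₁ hP hR hT e₁₁, h₁₂ hP hR hT e₁₂⟩
  have hB := sqrt_Ep_leW hc hP hR
  have hs : 0 ≤ Real.sqrt P.γ₀ := Real.sqrt_nonneg _
  nlinarith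

end StepPars

end JetStep

end Literature.Analysis.FluidPDE
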